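import Summits.BirchSwinnertonDyer.BirchSwinnertonDyer.Theses.TameQuarticManinParity
import HarnessLib

/-!
# Route `TameQuarticManinParity`, LINE 20 (bsd-idea-3 g7), glue G20♭ `TprimeRedNeronUnitOfKodairaThree`
# (stmt-BirchSwinnertonDyer-27923) — PROVED BY NAME (the planner's `Sketch20b-LINE20-converse.lean` argument)

Cell `pub/bsd-wall`, D-0145 line `route-BirchSwinnertonDyer-TeichmullerTwistDescent`, seat `bsd-line-ttd-p1` g9,
working the planner-of-record's TQMP LINE 20. BSD is NOT proved by this; Manin's conjecture is not proved by this;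
F19♭ (`TprimeRedKodairaThreeForcesNeronUnit`, stmt-27922), E19 (`TprimeRedOptimalIsKodairaThree`, stmt-27752) and
U19 (`TprimeRedOptimalIsogenyNeronUnit`, stmt-27879) stay OPEN. This file closes ONLY the converse glue; with G20
(stmt-27892) it records U19 ⟺ E19 on the route (critic V103: one reader organ).

## Statement (verbatim the route decl)

`TprimeRedKodairaThreeForcesNeronUnit → TprimeRedOptimalIsKodairaThree → TprimeRedOptimalIsogenyNeronUnit`.

## Proof

Instantiate F19♭ at the datum's own Néron lattice `L := D.L` (`D.isNeronLattice`) and at `v₃(Δ_min W) = 3` supplied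
by E19 on U19's binders. Pure logic. Design: theorems only; no definition, no named fact, no `sorry`; axioms
`propext`, `Classical.choice`, `Quot.sound`.
-/

set_option autoImplicit false
-- D-0017: single-problem summit, so `Summit.BirchSwinnertonDyer.BirchSwinnertonDyer.…` repeats a namespace BY DESIGN.
set_option linter.dupNamespace false

namespace Summit.BirchSwinnertonDyer.BirchSwinnertonDyer.Theorems.TameQuarticManinParity

open Summit.BirchSwinnertonDyer.BirchSwinnertonDyer.Theses.TameQuarticManinParity

/-- **Glue G20♭** (stmt-BirchSwinnertonDyer-27923), by name: F19♭ (Kodaira III at `3` forces every index-`3` Néron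
sublattice relation to have `3 ∤ α`) ∧ E19 (the optimal curve is Kodaira III) ⟹ U19, at `L := D.L`
(`D.isNeronLattice`) — the planner's `Sketch20b.tprimeRedNeronUnitOfKodairaThree_proof`. -/
theorem tprimeRedNeronUnitOfKodairaThree_proof : TprimeRedNeronUnitOfKodairaThree := by
  unfold TprimeRedNeronUnitOfKodairaThree
  intro hF hE W _ _ _ hcm hadd ht hred D hopt hdeg W₂ _ _ L₂ α hL₂ hsub hidx
  exact hF W hadd ht (hE W hcm hadd ht hred D hopt hdeg) W₂ D.L L₂ α D.isNeronLattice hL₂ hsub hidx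

end Summit.BirchSwinnertonDyer.BirchSwinnertonDyer.Theorems.TameQuarticManinParity
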